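import Mathlib
import Summits.KontsevichZagierPeriods.Zeta5Search.Families.DualSpanProdCoeff
import Literature.RingTheory.MvPolynomial.WeightOperators
import HarnessLib

/-!
# ζ(5) search — Families: the TRANSLATION MODULE of the dual span product — the seven first-order Stokes
# relations among the coefficients of `dualSpanProd`, one per marked point of the dual configuration

HONEST FRAMING: systematic search; no irrationality claim unless certified.  Cell `pub-zeta5`, certifier 2
(cert-2 g7, 2026-08-21).  Identities between integers (coefficients of integer polynomials); no conjecture node is
used; nothing about `ζ(5)`; no number of record moves.

WHAT.  In the gap coordinates `g₀,…,g₅` of the dual configuration (`w₇ = ∞`), the marked point `w_j` is translated by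
`∂/∂w_j = ∂_{g_{j−1}} − ∂_{g_j}` (`j = 1,…,5`), `∂/∂w₆ = ∂_{g₅}`, `∂/∂w₀ = −∂_{g₀}`.  Applied to P2 g6's dual span
product `N_A = dualSpanProd A = ∏_e L_e^{A_e}` (`Families/DualConstantTerm`; finite spans `{1,2}` (A₀), `{1,…,5}` (A₁),
`{2,…,5}` (A₂), `{2,3,4}` (A₃), `{0,1,2,3}` (A₆), `{0,1,2}` (A₇)), Leibniz gives `D_j N_A = Σ_e ±A_e N_{A−e}` over the
spans containing exactly one of the two adjacent gaps (`pderiv_transl0 … pderiv_transl6`), and the coefficient identity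
`[m](X_w ∂_w F) = m_w [m]F` (`Literature.RingTheory.MvPolynomial.coeff_X_mul_pderiv`) turns each into a linear relation
among coefficients (= constant terms of the Laurent polynomials `Λ = N/g^B`) on the 12-parameter exponent lattice
`(A_fin, B)` of McCarthy–Osburn–Straub's torus periods [MOS20, §3.2]:
  `T_j : (B_{j−1}+1)·[g^{B+e_{j−1}}]N_A − (B_j+1)·[g^{B+e_j}]N_A = Σ_e ±A_e·[g^B]N_{A−e}`   (`j = 1,…,5`),
  `T₀ : (B₀+1)·[g^{B+e₀}]N_A = A₆[g^B]N_{A−e₆} + A₇[g^B]N_{A−e₇}`,  `T₆ : (B₅+1)·[g^{B+e₅}]N_A = A₁[…] + A₂[…]`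
(`coeff_transl0 … coeff_transl6`; valid for ALL `A, B`, exponents `A_e − 1` truncated at `0` where `A_e = 0` kills the
term).  `T₅` is, after the change of variables `B ↦ B − e₅`, exactly `DualCT.coeff_star35` of
`Families/DualConstantTermStar35` = gen-1's STAR(3,5) for the dual constant term — the ONLY translation that stays
inside the 8-dimensional Brown–Zudilin sublattice `(bzNum, bzDen)`; the other STAR/PENCIL relations of
`WedgeDictionaryThreeTerm` are integer combinations of the `T_j` taken at neighbouring exponents (plan
`HOME/cert-2/g7/DEXACT-PLAN.md`; numerically the signed constant term satisfies all of them, `star_test.py`).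
These seven relations generate every first-order Stokes relation with polynomial coefficients (a vector field
`Σ C_w(g)θ_w` with Laurent-polynomial `C_w` acts by the `T_j` at shifted exponents).
-/

noncomputable section
open MvPolynomial Finset
open Literature.RingTheory.MvPolynomial (coeff_X_mul_pderiv)

namespace Summit.KontsevichZagierPeriods.Zeta5Search.Families.Cellular
namespace DualCT

/-- Translation by `−∂₀ (the marked point w₀)`: `D(dualSpanProd A)` in terms of the span products with one
exponent lowered
(the spans that contain exactly one of the two adjacent gaps: `{0,1,2,3}` (−A6), `{0,1,2}` (−A7)). -/
theorem pderiv_transl0 (A : Fin 8 → ℕ) :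
    -pderiv 0 (dualSpanProd A) =
      -((A 6 : ℕ) : P6) * dualSpanProd (Function.update A 6 (A 6 - 1))
        - ((A 7 : ℕ) : P6) * dualSpanProd (Function.update A 7 (A 7 - 1)) := by
  unfold dualSpanProd
  simp only [Function.update_self, Function.update_of_ne (by decide : (0 : Fin 8) ≠ 6),
    Function.update_of_ne (by decide : (1 : Fin 8) ≠ 6), Function.update_of_ne (by decide : (2 : Fin 8) ≠ 6),
    Function.update_of_ne (by decide : (3 : Fin 8) ≠ 6), Function.update_of_ne (by decide : (7 : Fin 8) ≠ 6),
    Function.update_of_ne (by decide : (0 : Fin 8) ≠ 7), Function.update_of_ne (by decide : (1 : Fin 8) ≠ 7),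
    Function.update_of_ne (by decide : (2 : Fin 8) ≠ 7), Function.update_of_ne (by decide : (3 : Fin 8) ≠ 7),
    Function.update_of_ne (by decide : (6 : Fin 8) ≠ 7), pderiv_mul, pderiv_pow, map_add, pderiv_X_self,
    pderiv_X_of_ne (show (1 : Fin 6) ≠ 0 by decide), pderiv_X_of_ne (show (2 : Fin 6) ≠ 0 by decide),
    pderiv_X_of_ne (show (3 : Fin 6) ≠ 0 by decide), pderiv_X_of_ne (show (4 : Fin 6) ≠ 0 by decide),
    pderiv_X_of_ne (show (5 : Fin 6) ≠ 0 by decide)]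
  ring

/-- **Translation relation T0** (marked point `w0`): `(B0+1)·[g^(B+e0)]N_A = Σ A_e·[g^B]N_(A−e)` over
the spans through `g0`. -/
theorem coeff_transl0 (A : Fin 8 → ℕ) (B : Fin 6 →₀ ℕ) :
    ((B 0 : ℤ) + 1) * coeff (B + Finsupp.single 0 1) (dualSpanProd A) =
      (A 6 : ℤ) * coeff B (dualSpanProd (Function.update A 6 (A 6 - 1)))
        + (A 7 : ℤ) * coeff B (dualSpanProd (Function.update A 7 (A 7 - 1))) := by
  set N := dualSpanProd A with hN
  have hD := pderiv_transl0 A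
  have key : X 0 * pderiv 0 N =
      C (((A 6 : ℕ) : ℤ)) * (X 0 * dualSpanProd (Function.update A 6 (A 6 - 1)))
        + C (((A 7 : ℕ) : ℤ)) * (X 0 * dualSpanProd (Function.update A 7 (A 7 - 1))) := by
    simp only [map_natCast]
    linear_combination -(X 0 : P6) * hD
  have hw : (0 : Fin 6) ∈ (B + Finsupp.single 0 1).support := by simp
  have ew : B + Finsupp.single 0 1 - Finsupp.single 0 1 = B := add_tsub_cancel_right _ _
  have cw : ((B + Finsupp.single 0 1 : Fin 6 →₀ ℕ) 0 : ℕ) = B 0 + 1 := by simp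
  have hk := congrArg (coeff (B + Finsupp.single 0 1)) key
  simp only [coeff_add, coeff_C_mul] at hk
  rw [coeff_X_mul_pderiv, cw, coeff_X_mul', if_pos hw, ew, coeff_X_mul', if_pos hw, ew] at hk
  push_cast at hk ⊢
  linear_combination hk

/-- Translation by `∂0 − ∂1 (the marked point w1)`: `D(dualSpanProd A)` in terms of the span products with one
exponent lowered
(the spans that contain exactly one of the two adjacent gaps: `{1,2}` (−A0), `{1,…,5}` (−A1)). -/
theorem pderiv_transl1 (A : Fin 8 → ℕ) :
    pderiv 0 (dualSpanProd A) - pderiv 1 (dualSpanProd A) =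
      -((A 0 : ℕ) : P6) * dualSpanProd (Function.update A 0 (A 0 - 1))
        - ((A 1 : ℕ) : P6) * dualSpanProd (Function.update A 1 (A 1 - 1)) := by
  unfold dualSpanProd
  simp only [Function.update_self, Function.update_of_ne (by decide : (1 : Fin 8) ≠ 0),
    Function.update_of_ne (by decide : (2 : Fin 8) ≠ 0), Function.update_of_ne (by decide : (3 : Fin 8) ≠ 0),
    Function.update_of_ne (by decide : (6 : Fin 8) ≠ 0), Function.update_of_ne (by decide : (7 : Fin 8) ≠ 0),
    Function.update_of_ne (by decide : (0 : Fin 8) ≠ 1), Function.update_of_ne (by decide : (2 : Fin 8) ≠ 1),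
    Function.update_of_ne (by decide : (3 : Fin 8) ≠ 1), Function.update_of_ne (by decide : (6 : Fin 8) ≠ 1),
    Function.update_of_ne (by decide : (7 : Fin 8) ≠ 1), pderiv_mul, pderiv_pow, map_add, pderiv_X_self,
    pderiv_X_of_ne (show (1 : Fin 6) ≠ 0 by decide), pderiv_X_of_ne (show (2 : Fin 6) ≠ 0 by decide),
    pderiv_X_of_ne (show (3 : Fin 6) ≠ 0 by decide), pderiv_X_of_ne (show (4 : Fin 6) ≠ 0 by decide),
    pderiv_X_of_ne (show (5 : Fin 6) ≠ 0 by decide), pderiv_X_of_ne (show (0 : Fin 6) ≠ 1 by decide),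
    pderiv_X_of_ne (show (2 : Fin 6) ≠ 1 by decide), pderiv_X_of_ne (show (3 : Fin 6) ≠ 1 by decide),
    pderiv_X_of_ne (show (4 : Fin 6) ≠ 1 by decide), pderiv_X_of_ne (show (5 : Fin 6) ≠ 1 by decide)]
  ring

/-- **Translation relation T1** (marked point `w1`) among the coefficients of the dual span products:
`(B0+1)·[g^(B+e0)]N_A − (B1+1)·[g^(B+e1)]N_A = Σ ±A_e·[g^B]N_(A−e)` over the spans that move. -/
theorem coeff_transl1 (A : Fin 8 → ℕ) (B : Fin 6 →₀ ℕ) :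
    ((B 0 : ℤ) + 1) * coeff (B + Finsupp.single 0 1) (dualSpanProd A)
      - ((B 1 : ℤ) + 1) * coeff (B + Finsupp.single 1 1) (dualSpanProd A) =
      -(A 0 : ℤ) * coeff B (dualSpanProd (Function.update A 0 (A 0 - 1)))
        - (A 1 : ℤ) * coeff B (dualSpanProd (Function.update A 1 (A 1 - 1))) := by
  set N := dualSpanProd A with hN
  have hD := pderiv_transl1 A
  have key : X 1 * (X 0 * pderiv 0 N) - X 0 * (X 1 * pderiv 1 N) =
      C (-((A 0 : ℕ) : ℤ)) * (X 0 * (X 1 * dualSpanProd (Function.update A 0 (A 0 - 1))))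
        + C (-((A 1 : ℕ) : ℤ)) * (X 0 * (X 1 * dualSpanProd (Function.update A 1 (A 1 - 1)))) := by
    simp only [map_neg, map_natCast]
    linear_combination (X 0 * X 1 : P6) * hD
  have hu : (0 : Fin 6) ∈ (B + Finsupp.single 0 1 + Finsupp.single 1 1).support := by simp
  have hv : (1 : Fin 6) ∈ (B + Finsupp.single 0 1 + Finsupp.single 1 1).support := by simp
  have ev : B + Finsupp.single 0 1 + Finsupp.single 1 1 - Finsupp.single 1 1 = B + Finsupp.single 0 1 :=
    add_tsub_cancel_right _ _
  have eu : B + Finsupp.single 0 1 + Finsupp.single 1 1 - Finsupp.single 0 1 = B + Finsupp.single 1 1 := by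
    rw [add_right_comm]; exact add_tsub_cancel_right _ _
  have hv' : (1 : Fin 6) ∈ (B + Finsupp.single 1 1).support := by simp
  have euv : B + Finsupp.single 1 1 - Finsupp.single 1 1 = B := add_tsub_cancel_right _ _
  have cu : ((B + Finsupp.single 0 1 : Fin 6 →₀ ℕ) 0 : ℕ) = B 0 + 1 := by simp
  have cv : ((B + Finsupp.single 1 1 : Fin 6 →₀ ℕ) 1 : ℕ) = B 1 + 1 := by simp
  have hk := congrArg (coeff (B + Finsupp.single 0 1 + Finsupp.single 1 1)) key
  simp only [coeff_sub, coeff_add, coeff_C_mul] at hk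
  rw [coeff_X_mul', if_pos hv, ev, coeff_X_mul_pderiv, cu, coeff_X_mul', if_pos hu, eu, coeff_X_mul_pderiv, cv,
    coeff_X_mul', if_pos hu, eu, coeff_X_mul', if_pos hv', euv, coeff_X_mul', if_pos hu, eu, coeff_X_mul',
    if_pos hv', euv] at hk
  push_cast at hk ⊢
  linear_combination hk

/-- Translation by `∂1 − ∂2 (the marked point w2)`: `D(dualSpanProd A)` in terms of the span products with one
exponent lowered
(the spans that contain exactly one of the two adjacent gaps: `{2,…,5}` (−A2), `{2,3,4}` (−A3)). -/
theorem pderiv_transl2 (A : Fin 8 → ℕ) :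
    pderiv 1 (dualSpanProd A) - pderiv 2 (dualSpanProd A) =
      -((A 2 : ℕ) : P6) * dualSpanProd (Function.update A 2 (A 2 - 1))
        - ((A 3 : ℕ) : P6) * dualSpanProd (Function.update A 3 (A 3 - 1)) := by
  unfold dualSpanProd
  simp only [Function.update_self, Function.update_of_ne (by decide : (0 : Fin 8) ≠ 2),
    Function.update_of_ne (by decide : (1 : Fin 8) ≠ 2), Function.update_of_ne (by decide : (3 : Fin 8) ≠ 2),
    Function.update_of_ne (by decide : (6 : Fin 8) ≠ 2), Function.update_of_ne (by decide : (7 : Fin 8) ≠ 2),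
    Function.update_of_ne (by decide : (0 : Fin 8) ≠ 3), Function.update_of_ne (by decide : (1 : Fin 8) ≠ 3),
    Function.update_of_ne (by decide : (2 : Fin 8) ≠ 3), Function.update_of_ne (by decide : (6 : Fin 8) ≠ 3),
    Function.update_of_ne (by decide : (7 : Fin 8) ≠ 3), pderiv_mul, pderiv_pow, map_add, pderiv_X_self,
    pderiv_X_of_ne (show (0 : Fin 6) ≠ 1 by decide), pderiv_X_of_ne (show (2 : Fin 6) ≠ 1 by decide),
    pderiv_X_of_ne (show (3 : Fin 6) ≠ 1 by decide), pderiv_X_of_ne (show (4 : Fin 6) ≠ 1 by decide),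
    pderiv_X_of_ne (show (5 : Fin 6) ≠ 1 by decide), pderiv_X_of_ne (show (0 : Fin 6) ≠ 2 by decide),
    pderiv_X_of_ne (show (1 : Fin 6) ≠ 2 by decide), pderiv_X_of_ne (show (3 : Fin 6) ≠ 2 by decide),
    pderiv_X_of_ne (show (4 : Fin 6) ≠ 2 by decide), pderiv_X_of_ne (show (5 : Fin 6) ≠ 2 by decide)]
  ring

/-- **Translation relation T2** (marked point `w2`) among the coefficients of the dual span products:
`(B1+1)·[g^(B+e1)]N_A − (B2+1)·[g^(B+e2)]N_A = Σ ±A_e·[g^B]N_(A−e)` over the spans that move. -/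
theorem coeff_transl2 (A : Fin 8 → ℕ) (B : Fin 6 →₀ ℕ) :
    ((B 1 : ℤ) + 1) * coeff (B + Finsupp.single 1 1) (dualSpanProd A)
      - ((B 2 : ℤ) + 1) * coeff (B + Finsupp.single 2 1) (dualSpanProd A) =
      -(A 2 : ℤ) * coeff B (dualSpanProd (Function.update A 2 (A 2 - 1)))
        - (A 3 : ℤ) * coeff B (dualSpanProd (Function.update A 3 (A 3 - 1))) := by
  set N := dualSpanProd A with hN
  have hD := pderiv_transl2 A
  have key : X 2 * (X 1 * pderiv 1 N) - X 1 * (X 2 * pderiv 2 N) =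
      C (-((A 2 : ℕ) : ℤ)) * (X 1 * (X 2 * dualSpanProd (Function.update A 2 (A 2 - 1))))
        + C (-((A 3 : ℕ) : ℤ)) * (X 1 * (X 2 * dualSpanProd (Function.update A 3 (A 3 - 1)))) := by
    simp only [map_neg, map_natCast]
    linear_combination (X 1 * X 2 : P6) * hD
  have hu : (1 : Fin 6) ∈ (B + Finsupp.single 1 1 + Finsupp.single 2 1).support := by simp
  have hv : (2 : Fin 6) ∈ (B + Finsupp.single 1 1 + Finsupp.single 2 1).support := by simp
  have ev : B + Finsupp.single 1 1 + Finsupp.single 2 1 - Finsupp.single 2 1 = B + Finsupp.single 1 1 :=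
    add_tsub_cancel_right _ _
  have eu : B + Finsupp.single 1 1 + Finsupp.single 2 1 - Finsupp.single 1 1 = B + Finsupp.single 2 1 := by
    rw [add_right_comm]; exact add_tsub_cancel_right _ _
  have hv' : (2 : Fin 6) ∈ (B + Finsupp.single 2 1).support := by simp
  have euv : B + Finsupp.single 2 1 - Finsupp.single 2 1 = B := add_tsub_cancel_right _ _
  have cu : ((B + Finsupp.single 1 1 : Fin 6 →₀ ℕ) 1 : ℕ) = B 1 + 1 := by simp
  have cv : ((B + Finsupp.single 2 1 : Fin 6 →₀ ℕ) 2 : ℕ) = B 2 + 1 := by simp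
  have hk := congrArg (coeff (B + Finsupp.single 1 1 + Finsupp.single 2 1)) key
  simp only [coeff_sub, coeff_add, coeff_C_mul] at hk
  rw [coeff_X_mul', if_pos hv, ev, coeff_X_mul_pderiv, cu, coeff_X_mul', if_pos hu, eu, coeff_X_mul_pderiv, cv,
    coeff_X_mul', if_pos hu, eu, coeff_X_mul', if_pos hv', euv, coeff_X_mul', if_pos hu, eu, coeff_X_mul',
    if_pos hv', euv] at hk
  push_cast at hk ⊢
  linear_combination hk

/-- Translation by `∂2 − ∂3 (the marked point w3)`: `D(dualSpanProd A)` in terms of the span products with one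
exponent lowered
(the spans that contain exactly one of the two adjacent gaps: `{1,2}` (+A0), `{0,1,2}` (+A7)). -/
theorem pderiv_transl3 (A : Fin 8 → ℕ) :
    pderiv 2 (dualSpanProd A) - pderiv 3 (dualSpanProd A) =
      ((A 0 : ℕ) : P6) * dualSpanProd (Function.update A 0 (A 0 - 1))
        + ((A 7 : ℕ) : P6) * dualSpanProd (Function.update A 7 (A 7 - 1)) := by
  unfold dualSpanProd
  simp only [Function.update_self, Function.update_of_ne (by decide : (1 : Fin 8) ≠ 0),
    Function.update_of_ne (by decide : (2 : Fin 8) ≠ 0), Function.update_of_ne (by decide : (3 : Fin 8) ≠ 0),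
    Function.update_of_ne (by decide : (6 : Fin 8) ≠ 0), Function.update_of_ne (by decide : (7 : Fin 8) ≠ 0),
    Function.update_of_ne (by decide : (0 : Fin 8) ≠ 7), Function.update_of_ne (by decide : (1 : Fin 8) ≠ 7),
    Function.update_of_ne (by decide : (2 : Fin 8) ≠ 7), Function.update_of_ne (by decide : (3 : Fin 8) ≠ 7),
    Function.update_of_ne (by decide : (6 : Fin 8) ≠ 7), pderiv_mul, pderiv_pow, map_add, pderiv_X_self,
    pderiv_X_of_ne (show (0 : Fin 6) ≠ 2 by decide), pderiv_X_of_ne (show (1 : Fin 6) ≠ 2 by decide),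
    pderiv_X_of_ne (show (3 : Fin 6) ≠ 2 by decide), pderiv_X_of_ne (show (4 : Fin 6) ≠ 2 by decide),
    pderiv_X_of_ne (show (5 : Fin 6) ≠ 2 by decide), pderiv_X_of_ne (show (0 : Fin 6) ≠ 3 by decide),
    pderiv_X_of_ne (show (1 : Fin 6) ≠ 3 by decide), pderiv_X_of_ne (show (2 : Fin 6) ≠ 3 by decide),
    pderiv_X_of_ne (show (4 : Fin 6) ≠ 3 by decide), pderiv_X_of_ne (show (5 : Fin 6) ≠ 3 by decide)]
  ring

/-- **Translation relation T3** (marked point `w3`) among the coefficients of the dual span products: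
`(B2+1)·[g^(B+e2)]N_A − (B3+1)·[g^(B+e3)]N_A = Σ ±A_e·[g^B]N_(A−e)` over the spans that move. -/
theorem coeff_transl3 (A : Fin 8 → ℕ) (B : Fin 6 →₀ ℕ) :
    ((B 2 : ℤ) + 1) * coeff (B + Finsupp.single 2 1) (dualSpanProd A)
      - ((B 3 : ℤ) + 1) * coeff (B + Finsupp.single 3 1) (dualSpanProd A) =
      (A 0 : ℤ) * coeff B (dualSpanProd (Function.update A 0 (A 0 - 1)))
        + (A 7 : ℤ) * coeff B (dualSpanProd (Function.update A 7 (A 7 - 1))) := by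
  set N := dualSpanProd A with hN
  have hD := pderiv_transl3 A
  have key : X 3 * (X 2 * pderiv 2 N) - X 2 * (X 3 * pderiv 3 N) =
      C (((A 0 : ℕ) : ℤ)) * (X 2 * (X 3 * dualSpanProd (Function.update A 0 (A 0 - 1))))
        + C (((A 7 : ℕ) : ℤ)) * (X 2 * (X 3 * dualSpanProd (Function.update A 7 (A 7 - 1)))) := by
    simp only [map_natCast]
    linear_combination (X 2 * X 3 : P6) * hD
  have hu : (2 : Fin 6) ∈ (B + Finsupp.single 2 1 + Finsupp.single 3 1).support := by simp
  have hv : (3 : Fin 6) ∈ (B + Finsupp.single 2 1 + Finsupp.single 3 1).support := by simp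
  have ev : B + Finsupp.single 2 1 + Finsupp.single 3 1 - Finsupp.single 3 1 = B + Finsupp.single 2 1 :=
    add_tsub_cancel_right _ _
  have eu : B + Finsupp.single 2 1 + Finsupp.single 3 1 - Finsupp.single 2 1 = B + Finsupp.single 3 1 := by
    rw [add_right_comm]; exact add_tsub_cancel_right _ _
  have hv' : (3 : Fin 6) ∈ (B + Finsupp.single 3 1).support := by simp
  have euv : B + Finsupp.single 3 1 - Finsupp.single 3 1 = B := add_tsub_cancel_right _ _
  have cu : ((B + Finsupp.single 2 1 : Fin 6 →₀ ℕ) 2 : ℕ) = B 2 + 1 := by simp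
  have cv : ((B + Finsupp.single 3 1 : Fin 6 →₀ ℕ) 3 : ℕ) = B 3 + 1 := by simp
  have hk := congrArg (coeff (B + Finsupp.single 2 1 + Finsupp.single 3 1)) key
  simp only [coeff_sub, coeff_add, coeff_C_mul] at hk
  rw [coeff_X_mul', if_pos hv, ev, coeff_X_mul_pderiv, cu, coeff_X_mul', if_pos hu, eu, coeff_X_mul_pderiv, cv,
    coeff_X_mul', if_pos hu, eu, coeff_X_mul', if_pos hv', euv, coeff_X_mul', if_pos hu, eu, coeff_X_mul',
    if_pos hv', euv] at hk
  push_cast at hk ⊢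
  linear_combination hk

/-- Translation by `∂3 − ∂4 (the marked point w4)`: `D(dualSpanProd A)` in terms of the span products with one
exponent lowered
(the spans that contain exactly one of the two adjacent gaps: `{0,1,2,3}` (+A6)). -/
theorem pderiv_transl4 (A : Fin 8 → ℕ) :
    pderiv 3 (dualSpanProd A) - pderiv 4 (dualSpanProd A) =
      ((A 6 : ℕ) : P6) * dualSpanProd (Function.update A 6 (A 6 - 1)) := by
  unfold dualSpanProd
  simp only [Function.update_self, Function.update_of_ne (by decide : (0 : Fin 8) ≠ 6),
    Function.update_of_ne (by decide : (1 : Fin 8) ≠ 6), Function.update_of_ne (by decide : (2 : Fin 8) ≠ 6),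
    Function.update_of_ne (by decide : (3 : Fin 8) ≠ 6), Function.update_of_ne (by decide : (7 : Fin 8) ≠ 6),
    pderiv_mul, pderiv_pow, map_add, pderiv_X_self, pderiv_X_of_ne (show (0 : Fin 6) ≠ 3 by decide),
    pderiv_X_of_ne (show (1 : Fin 6) ≠ 3 by decide), pderiv_X_of_ne (show (2 : Fin 6) ≠ 3 by decide),
    pderiv_X_of_ne (show (4 : Fin 6) ≠ 3 by decide), pderiv_X_of_ne (show (5 : Fin 6) ≠ 3 by decide),
    pderiv_X_of_ne (show (0 : Fin 6) ≠ 4 by decide), pderiv_X_of_ne (show (1 : Fin 6) ≠ 4 by decide),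
    pderiv_X_of_ne (show (2 : Fin 6) ≠ 4 by decide), pderiv_X_of_ne (show (3 : Fin 6) ≠ 4 by decide),
    pderiv_X_of_ne (show (5 : Fin 6) ≠ 4 by decide)]
  ring

/-- **Translation relation T4** (marked point `w4`) among the coefficients of the dual span products:
`(B3+1)·[g^(B+e3)]N_A − (B4+1)·[g^(B+e4)]N_A = Σ ±A_e·[g^B]N_(A−e)` over the spans that move. -/
theorem coeff_transl4 (A : Fin 8 → ℕ) (B : Fin 6 →₀ ℕ) :
    ((B 3 : ℤ) + 1) * coeff (B + Finsupp.single 3 1) (dualSpanProd A)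
      - ((B 4 : ℤ) + 1) * coeff (B + Finsupp.single 4 1) (dualSpanProd A) =
      (A 6 : ℤ) * coeff B (dualSpanProd (Function.update A 6 (A 6 - 1))) := by
  set N := dualSpanProd A with hN
  have hD := pderiv_transl4 A
  have key : X 4 * (X 3 * pderiv 3 N) - X 3 * (X 4 * pderiv 4 N) =
      C (((A 6 : ℕ) : ℤ)) * (X 3 * (X 4 * dualSpanProd (Function.update A 6 (A 6 - 1)))) := by
    simp only [map_natCast]
    linear_combination (X 3 * X 4 : P6) * hD
  have hu : (3 : Fin 6) ∈ (B + Finsupp.single 3 1 + Finsupp.single 4 1).support := by simp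
  have hv : (4 : Fin 6) ∈ (B + Finsupp.single 3 1 + Finsupp.single 4 1).support := by simp
  have ev : B + Finsupp.single 3 1 + Finsupp.single 4 1 - Finsupp.single 4 1 = B + Finsupp.single 3 1 :=
    add_tsub_cancel_right _ _
  have eu : B + Finsupp.single 3 1 + Finsupp.single 4 1 - Finsupp.single 3 1 = B + Finsupp.single 4 1 := by
    rw [add_right_comm]; exact add_tsub_cancel_right _ _
  have hv' : (4 : Fin 6) ∈ (B + Finsupp.single 4 1).support := by simp
  have euv : B + Finsupp.single 4 1 - Finsupp.single 4 1 = B := add_tsub_cancel_right _ _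
  have cu : ((B + Finsupp.single 3 1 : Fin 6 →₀ ℕ) 3 : ℕ) = B 3 + 1 := by simp
  have cv : ((B + Finsupp.single 4 1 : Fin 6 →₀ ℕ) 4 : ℕ) = B 4 + 1 := by simp
  have hk := congrArg (coeff (B + Finsupp.single 3 1 + Finsupp.single 4 1)) key
  simp only [coeff_sub, coeff_C_mul] at hk
  rw [coeff_X_mul', if_pos hv, ev, coeff_X_mul_pderiv, cu, coeff_X_mul', if_pos hu, eu, coeff_X_mul_pderiv, cv,
    coeff_X_mul', if_pos hu, eu, coeff_X_mul', if_pos hv', euv] at hk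
  push_cast at hk ⊢
  linear_combination hk

/-- Translation by `∂4 − ∂5 (the marked point w5)`: `D(dualSpanProd A)` in terms of the span products with one
exponent lowered
(the spans that contain exactly one of the two adjacent gaps: `{2,3,4}` (+A3)). -/
theorem pderiv_transl5 (A : Fin 8 → ℕ) :
    pderiv 4 (dualSpanProd A) - pderiv 5 (dualSpanProd A) =
      ((A 3 : ℕ) : P6) * dualSpanProd (Function.update A 3 (A 3 - 1)) := by
  unfold dualSpanProd
  simp only [Function.update_self, Function.update_of_ne (by decide : (0 : Fin 8) ≠ 3),
    Function.update_of_ne (by decide : (1 : Fin 8) ≠ 3), Function.update_of_ne (by decide : (2 : Fin 8) ≠ 3),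
    Function.update_of_ne (by decide : (6 : Fin 8) ≠ 3), Function.update_of_ne (by decide : (7 : Fin 8) ≠ 3),
    pderiv_mul, pderiv_pow, map_add, pderiv_X_self, pderiv_X_of_ne (show (0 : Fin 6) ≠ 4 by decide),
    pderiv_X_of_ne (show (1 : Fin 6) ≠ 4 by decide), pderiv_X_of_ne (show (2 : Fin 6) ≠ 4 by decide),
    pderiv_X_of_ne (show (3 : Fin 6) ≠ 4 by decide), pderiv_X_of_ne (show (5 : Fin 6) ≠ 4 by decide),
    pderiv_X_of_ne (show (0 : Fin 6) ≠ 5 by decide), pderiv_X_of_ne (show (1 : Fin 6) ≠ 5 by decide),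
    pderiv_X_of_ne (show (2 : Fin 6) ≠ 5 by decide), pderiv_X_of_ne (show (3 : Fin 6) ≠ 5 by decide),
    pderiv_X_of_ne (show (4 : Fin 6) ≠ 5 by decide)]
  ring

/-- **Translation relation T5** (marked point `w5`) among the coefficients of the dual span products:
`(B4+1)·[g^(B+e4)]N_A − (B5+1)·[g^(B+e5)]N_A = Σ ±A_e·[g^B]N_(A−e)` over the spans that move. -/
theorem coeff_transl5 (A : Fin 8 → ℕ) (B : Fin 6 →₀ ℕ) :
    ((B 4 : ℤ) + 1) * coeff (B + Finsupp.single 4 1) (dualSpanProd A)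
      - ((B 5 : ℤ) + 1) * coeff (B + Finsupp.single 5 1) (dualSpanProd A) =
      (A 3 : ℤ) * coeff B (dualSpanProd (Function.update A 3 (A 3 - 1))) := by
  set N := dualSpanProd A with hN
  have hD := pderiv_transl5 A
  have key : X 5 * (X 4 * pderiv 4 N) - X 4 * (X 5 * pderiv 5 N) =
      C (((A 3 : ℕ) : ℤ)) * (X 4 * (X 5 * dualSpanProd (Function.update A 3 (A 3 - 1)))) := by
    simp only [map_natCast]
    linear_combination (X 4 * X 5 : P6) * hD
  have hu : (4 : Fin 6) ∈ (B + Finsupp.single 4 1 + Finsupp.single 5 1).support := by simp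
  have hv : (5 : Fin 6) ∈ (B + Finsupp.single 4 1 + Finsupp.single 5 1).support := by simp
  have ev : B + Finsupp.single 4 1 + Finsupp.single 5 1 - Finsupp.single 5 1 = B + Finsupp.single 4 1 :=
    add_tsub_cancel_right _ _
  have eu : B + Finsupp.single 4 1 + Finsupp.single 5 1 - Finsupp.single 4 1 = B + Finsupp.single 5 1 := by
    rw [add_right_comm]; exact add_tsub_cancel_right _ _
  have hv' : (5 : Fin 6) ∈ (B + Finsupp.single 5 1).support := by simp
  have euv : B + Finsupp.single 5 1 - Finsupp.single 5 1 = B := add_tsub_cancel_right _ _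
  have cu : ((B + Finsupp.single 4 1 : Fin 6 →₀ ℕ) 4 : ℕ) = B 4 + 1 := by simp
  have cv : ((B + Finsupp.single 5 1 : Fin 6 →₀ ℕ) 5 : ℕ) = B 5 + 1 := by simp
  have hk := congrArg (coeff (B + Finsupp.single 4 1 + Finsupp.single 5 1)) key
  simp only [coeff_sub, coeff_C_mul] at hk
  rw [coeff_X_mul', if_pos hv, ev, coeff_X_mul_pderiv, cu, coeff_X_mul', if_pos hu, eu, coeff_X_mul_pderiv, cv,
    coeff_X_mul', if_pos hu, eu, coeff_X_mul', if_pos hv', euv] at hk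
  push_cast at hk ⊢
  linear_combination hk

/-- Translation by `∂₅ (the last finite marked point w₆)`: `D(dualSpanProd A)` in terms of the span products
with one exponent lowered
(the spans that contain exactly one of the two adjacent gaps: `{1,…,5}` (+A1), `{2,…,5}` (+A2)). -/
theorem pderiv_transl6 (A : Fin 8 → ℕ) :
    pderiv 5 (dualSpanProd A) =
      ((A 1 : ℕ) : P6) * dualSpanProd (Function.update A 1 (A 1 - 1))
        + ((A 2 : ℕ) : P6) * dualSpanProd (Function.update A 2 (A 2 - 1)) := by
  unfold dualSpanProd
  simp only [Function.update_self, Function.update_of_ne (by decide : (0 : Fin 8) ≠ 1),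
    Function.update_of_ne (by decide : (2 : Fin 8) ≠ 1), Function.update_of_ne (by decide : (3 : Fin 8) ≠ 1),
    Function.update_of_ne (by decide : (6 : Fin 8) ≠ 1), Function.update_of_ne (by decide : (7 : Fin 8) ≠ 1),
    Function.update_of_ne (by decide : (0 : Fin 8) ≠ 2), Function.update_of_ne (by decide : (1 : Fin 8) ≠ 2),
    Function.update_of_ne (by decide : (3 : Fin 8) ≠ 2), Function.update_of_ne (by decide : (6 : Fin 8) ≠ 2),
    Function.update_of_ne (by decide : (7 : Fin 8) ≠ 2), pderiv_mul, pderiv_pow, map_add, pderiv_X_self,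
    pderiv_X_of_ne (show (0 : Fin 6) ≠ 5 by decide), pderiv_X_of_ne (show (1 : Fin 6) ≠ 5 by decide),
    pderiv_X_of_ne (show (2 : Fin 6) ≠ 5 by decide), pderiv_X_of_ne (show (3 : Fin 6) ≠ 5 by decide),
    pderiv_X_of_ne (show (4 : Fin 6) ≠ 5 by decide)]
  ring

/-- **Translation relation T6** (marked point `w6`): `(B5+1)·[g^(B+e5)]N_A = Σ A_e·[g^B]N_(A−e)` over
the spans through `g5`. -/
theorem coeff_transl6 (A : Fin 8 → ℕ) (B : Fin 6 →₀ ℕ) :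
    ((B 5 : ℤ) + 1) * coeff (B + Finsupp.single 5 1) (dualSpanProd A) =
      (A 1 : ℤ) * coeff B (dualSpanProd (Function.update A 1 (A 1 - 1)))
        + (A 2 : ℤ) * coeff B (dualSpanProd (Function.update A 2 (A 2 - 1))) := by
  set N := dualSpanProd A with hN
  have hD := pderiv_transl6 A
  have key : X 5 * pderiv 5 N =
      C (((A 1 : ℕ) : ℤ)) * (X 5 * dualSpanProd (Function.update A 1 (A 1 - 1)))
        + C (((A 2 : ℕ) : ℤ)) * (X 5 * dualSpanProd (Function.update A 2 (A 2 - 1))) := by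
    simp only [map_natCast]
    linear_combination (X 5 : P6) * hD
  have hw : (5 : Fin 6) ∈ (B + Finsupp.single 5 1).support := by simp
  have ew : B + Finsupp.single 5 1 - Finsupp.single 5 1 = B := add_tsub_cancel_right _ _
  have cw : ((B + Finsupp.single 5 1 : Fin 6 →₀ ℕ) 5 : ℕ) = B 5 + 1 := by simp
  have hk := congrArg (coeff (B + Finsupp.single 5 1)) key
  simp only [coeff_add, coeff_C_mul] at hk
  rw [coeff_X_mul_pderiv, cw, coeff_X_mul', if_pos hw, ew, coeff_X_mul', if_pos hw, ew] at hk
  push_cast at hk ⊢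
  linear_combination hk


end DualCT
end Summit.KontsevichZagierPeriods.Zeta5Search.Families.Cellular
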